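import Literature.NumberTheory.LFunctions.DeBruijnPhiThetaTails
import HarnessLib

/-!
# Route `JensenPolynomials`, item `XiDeltaSqPos` (S-T5) — toolbox 1: the third and fourth derivatives of the
Pólya–de Bruijn kernel `Φ` and their theta series (RH-FREE; cell rh-jensen, HUMAN RULING D-0040)

Companion (problem-side, it serves only the zero-free discharge of the route's crux `XiDeltaSqPos`) of the Literature files `DeBruijnPhiDeriv.lean` (`Φ′ = deBruijnPhiDeriv`),
`DeBruijnPhiSecondDeriv.lean` (`Φ″ = deBruijnPhiDeriv₂`, the one-series forms in the frequencies `y_n = π(n+1)²e^{4u}`)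
and `DeBruijnPhiThetaTails.lean` (`Φ″` is even). For the tree's Rodgers–Tao-normalised kernel `Φ = deBruijnPhi` we add the
next two derivatives, which are the inputs of Csordas–Varga's proof that `log Φ(√t)` is strictly concave
(Csordas–Varga 1988, Theorem 2.2 — "a lengthy construction … established bounds for `Φ^{(j)}(t)` (`j = 1, …, 6`)",
Varga 1990 §3.3), i.e. of the strict Turán inequalities of the Taylor coefficients of `ξ` (Csordas–Norfolk–Varga 1986):

* `deBruijnPhiDeriv₃`, `deBruijnPhiDeriv₄` with `hasDerivAt_deBruijnPhiDeriv₂` (`(Φ″)′ = Φ‴`) and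
  `hasDerivAt_deBruijnPhiDeriv₃` (`(Φ‴)′ = Φ⁗`), as combinations of the tree's building blocks `E_{j,k}(2u)`
  (`E_{j,k}′ = (1/2 + 2j)E_{j,k} − 2E_{j+1,k+1}`):
  `Φ‴ = 3270E₂₂ − 4232E₃₃ + 1440E₄₄ − 375E₁₁ − 128E₅₅`,
  `Φ⁗ = 30930E₂₂ − 68096E₃₃ + 41408E₄₄ − 8448E₅₅ − 1875E₁₁ + 512E₆₆` (at `2u`);
* the generic degree-six term `phiPolyTerm6 a₁ … a₆ x n = (a₁y + ⋯ + a₆y⁶)e^{−y}`, `y = y_n(x) = π(n+1)²x`, with its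
  summability and sum, and the ONE-SERIES forms
  `Φ‴(u) = eᵘ ∑_n P₃(y_n)e^{−y_n}`, `P₃(y) = −128y⁵ + 1440y⁴ − 4232y³ + 3270y² − 375y` (`deBruijnPhiDeriv₃_eq_tsum`),
  `Φ⁗(u) = eᵘ ∑_n P₄(y_n)e^{−y_n}`, `P₄(y) = 512y⁶ − 8448y⁵ + 41408y⁴ − 68096y³ + 30930y² − 1875y`
  (`deBruijnPhiDeriv₄_eq_tsum`); the polynomials obey `P_{m+1}(y) = P_m(y) + 4y(P_m′(y) − P_m(y))`;
* parity: `Φ‴` is odd (`deBruijnPhiDeriv₃_neg_arg`), hence `Φ‴(0) = 0` (`deBruijnPhiDeriv₃_zero`).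

WHAT THIS IS NOT: nothing here bears on the zeros of `ζ`. Everything is proved (term-by-term differentiation is the tree's `hasDerivAt_expThetaMoment`); no named facts.
Not here: any sign information on `Φ‴`, `Φ⁗` (that is the numerical content of Csordas–Varga's lemmas, done by interval
arithmetic where it is used).

## References

* G. Csordas, R. S. Varga, *Moment inequalities and the Riemann hypothesis*, Constr. Approx. 4 (1988) 175–198,
  Theorem 2.2. [CsordasVarga1988]
* R. S. Varga, *Scientific Computation on Mathematical Problems and Conjectures*, SIAM (1990), §3.3, Theorem 3,
  (3.4)–(3.5). [Varga1990]
* E. C. Titchmarsh, *The Theory of the Riemann Zeta-Function*, 2nd ed. (1986), §10.1. [Titchmarsh1986]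
-/

noncomputable section

open Filter Topology Set
open scoped Real

-- D-0017: `Summit.RiemannHypothesis.RiemannHypothesis.…` duplicates the namespace BY DESIGN (single-problem summit).
set_option linter.dupNamespace false

namespace Summit.RiemannHypothesis.RiemannHypothesis.Theorems.JensenPolynomials

open Literature.NumberTheory.LFunctions

/-! ## 1. The third and fourth derivatives -/

/-- The third derivative of `Φ`:
`Φ‴(u) = 3270E_{2,2}(2u) − 4232E_{3,3}(2u) + 1440E_{4,4}(2u) − 375E_{1,1}(2u) − 128E_{5,5}(2u)`. -/
def deBruijnPhiDeriv₃ (u : ℝ) : ℝ :=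
  3270 * expThetaMoment 2 2 (2 * u) - 4232 * expThetaMoment 3 3 (2 * u) + 1440 * expThetaMoment 4 4 (2 * u) -
    375 * expThetaMoment 1 1 (2 * u) - 128 * expThetaMoment 5 5 (2 * u)

/-- The fourth derivative of `Φ`:
`Φ⁗(u) = 30930E_{2,2}(2u) − 68096E_{3,3}(2u) + 41408E_{4,4}(2u) − 8448E_{5,5}(2u) − 1875E_{1,1}(2u) + 512E_{6,6}(2u)`. -/
def deBruijnPhiDeriv₄ (u : ℝ) : ℝ :=
  30930 * expThetaMoment 2 2 (2 * u) - 68096 * expThetaMoment 3 3 (2 * u) + 41408 * expThetaMoment 4 4 (2 * u) -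
    8448 * expThetaMoment 5 5 (2 * u) - 1875 * expThetaMoment 1 1 (2 * u) + 512 * expThetaMoment 6 6 (2 * u)

/-- The derivative of `u ↦ E_{k,k}(2u)`: `(1 + 4k)E_{k,k}(2u) − 4E_{k+1,k+1}(2u)`. -/
theorem hasDerivAt_expThetaMoment_two_mul (k : ℕ) (u : ℝ) :
    HasDerivAt (fun u : ℝ => expThetaMoment k k (2 * u))
      ((1 + 4 * (k : ℝ)) * expThetaMoment k k (2 * u) - 4 * expThetaMoment (k + 1) (k + 1) (2 * u)) u := by
  have h2 : HasDerivAt (fun u : ℝ => 2 * u) 2 u := by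
    simpa using (hasDerivAt_id u).const_mul (2 : ℝ)
  have h := (hasDerivAt_expThetaMoment k k (2 * u)).comp u h2
  have e : ((1 / 2 + 2 * (k : ℝ)) * expThetaMoment k k (2 * u) - 2 * expThetaMoment (k + 1) (k + 1) (2 * u)) * 2 =
      (1 + 4 * (k : ℝ)) * expThetaMoment k k (2 * u) - 4 * expThetaMoment (k + 1) (k + 1) (2 * u) := by ring
  rw [← e]
  exact h

/-- `Φ″` is differentiable with derivative `Φ‴ = deBruijnPhiDeriv₃`. -/
theorem hasDerivAt_deBruijnPhiDeriv₂ (u : ℝ) : HasDerivAt deBruijnPhiDeriv₂ (deBruijnPhiDeriv₃ u) u := by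
  have hA := (hasDerivAt_expThetaMoment_two_mul 2 u).const_mul 330
  have hB := (hasDerivAt_expThetaMoment_two_mul 3 u).const_mul 224
  have hC := (hasDerivAt_expThetaMoment_two_mul 1 u).const_mul 75
  have hD := (hasDerivAt_expThetaMoment_two_mul 4 u).const_mul 32
  have h := ((hA.sub hB).sub hC).add hD
  have ef : deBruijnPhiDeriv₂ = fun u => 330 * expThetaMoment 2 2 (2 * u) - 224 * expThetaMoment 3 3 (2 * u) -
      75 * expThetaMoment 1 1 (2 * u) + 32 * expThetaMoment 4 4 (2 * u) := rfl
  have e : 330 * ((1 + 4 * ((2 : ℕ) : ℝ)) * expThetaMoment 2 2 (2 * u) - 4 * expThetaMoment (2 + 1) (2 + 1) (2 * u)) -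
      224 * ((1 + 4 * ((3 : ℕ) : ℝ)) * expThetaMoment 3 3 (2 * u) - 4 * expThetaMoment (3 + 1) (3 + 1) (2 * u)) -
      75 * ((1 + 4 * ((1 : ℕ) : ℝ)) * expThetaMoment 1 1 (2 * u) - 4 * expThetaMoment (1 + 1) (1 + 1) (2 * u)) +
      32 * ((1 + 4 * ((4 : ℕ) : ℝ)) * expThetaMoment 4 4 (2 * u) - 4 * expThetaMoment (4 + 1) (4 + 1) (2 * u)) =
      deBruijnPhiDeriv₃ u := by
    simp only [deBruijnPhiDeriv₃, Nat.cast_ofNat, Nat.cast_one]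
    norm_num
    ring
  rw [ef, ← e]
  exact h

/-- `Φ‴` is differentiable with derivative `Φ⁗ = deBruijnPhiDeriv₄`. -/
theorem hasDerivAt_deBruijnPhiDeriv₃ (u : ℝ) : HasDerivAt deBruijnPhiDeriv₃ (deBruijnPhiDeriv₄ u) u := by
  have hA := (hasDerivAt_expThetaMoment_two_mul 2 u).const_mul 3270
  have hB := (hasDerivAt_expThetaMoment_two_mul 3 u).const_mul 4232
  have hC := (hasDerivAt_expThetaMoment_two_mul 4 u).const_mul 1440
  have hD := (hasDerivAt_expThetaMoment_two_mul 1 u).const_mul 375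
  have hE := (hasDerivAt_expThetaMoment_two_mul 5 u).const_mul 128
  have h := (((hA.sub hB).add hC).sub hD).sub hE
  have ef : deBruijnPhiDeriv₃ = fun u => 3270 * expThetaMoment 2 2 (2 * u) - 4232 * expThetaMoment 3 3 (2 * u) +
      1440 * expThetaMoment 4 4 (2 * u) - 375 * expThetaMoment 1 1 (2 * u) - 128 * expThetaMoment 5 5 (2 * u) := rfl
  have e : 3270 * ((1 + 4 * ((2 : ℕ) : ℝ)) * expThetaMoment 2 2 (2 * u) - 4 * expThetaMoment (2 + 1) (2 + 1) (2 * u)) -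
      4232 * ((1 + 4 * ((3 : ℕ) : ℝ)) * expThetaMoment 3 3 (2 * u) - 4 * expThetaMoment (3 + 1) (3 + 1) (2 * u)) +
      1440 * ((1 + 4 * ((4 : ℕ) : ℝ)) * expThetaMoment 4 4 (2 * u) - 4 * expThetaMoment (4 + 1) (4 + 1) (2 * u)) -
      375 * ((1 + 4 * ((1 : ℕ) : ℝ)) * expThetaMoment 1 1 (2 * u) - 4 * expThetaMoment (1 + 1) (1 + 1) (2 * u)) -
      128 * ((1 + 4 * ((5 : ℕ) : ℝ)) * expThetaMoment 5 5 (2 * u) - 4 * expThetaMoment (5 + 1) (5 + 1) (2 * u)) =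
      deBruijnPhiDeriv₄ u := by
    simp only [deBruijnPhiDeriv₄, Nat.cast_ofNat, Nat.cast_one]
    norm_num
    ring
  rw [ef, ← e]
  exact h

/-- `deriv Φ″ = Φ‴`. -/
theorem deriv_deBruijnPhiDeriv₂ : deriv deBruijnPhiDeriv₂ = deBruijnPhiDeriv₃ :=
  funext fun u => (hasDerivAt_deBruijnPhiDeriv₂ u).deriv

/-- `deriv Φ‴ = Φ⁗`. -/
theorem deriv_deBruijnPhiDeriv₃ : deriv deBruijnPhiDeriv₃ = deBruijnPhiDeriv₄ :=
  funext fun u => (hasDerivAt_deBruijnPhiDeriv₃ u).deriv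

/-- `Φ‴` is continuous. -/
theorem continuous_deBruijnPhiDeriv₃ : Continuous deBruijnPhiDeriv₃ :=
  continuous_iff_continuousAt.2 fun u => (hasDerivAt_deBruijnPhiDeriv₃ u).continuousAt

/-- `Φ⁗` is continuous (a finite combination of the continuous `E_{j,k}`). -/
theorem continuous_deBruijnPhiDeriv₄ : Continuous deBruijnPhiDeriv₄ := by
  have hc : ∀ j k : ℕ, Continuous fun u : ℝ => expThetaMoment j k (2 * u) :=
    fun j k => (continuous_expThetaMoment j k).comp (continuous_const.mul continuous_id)
  unfold deBruijnPhiDeriv₄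
  exact (((((continuous_const.mul (hc 2 2)).sub (continuous_const.mul (hc 3 3))).add
    (continuous_const.mul (hc 4 4))).sub (continuous_const.mul (hc 5 5))).sub
    (continuous_const.mul (hc 1 1))).add (continuous_const.mul (hc 6 6))

/-! ## 2. The generic degree-six term and the one-series forms of `Φ‴`, `Φ⁗` -/

/-- The generic term `(a₁y + a₂y² + a₃y³ + a₄y⁴ + a₅y⁵ + a₆y⁶)e^{−y}` at `y = y_n(x) = π(n+1)²x`. -/
def phiPolyTerm6 (a₁ a₂ a₃ a₄ a₅ a₆ x : ℝ) (n : ℕ) : ℝ :=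
  (a₁ * thetaFreq x n + a₂ * thetaFreq x n ^ 2 + a₃ * thetaFreq x n ^ 3 + a₄ * thetaFreq x n ^ 4 +
    a₅ * thetaFreq x n ^ 5 + a₆ * thetaFreq x n ^ 6) * rexp (-thetaFreq x n)

/-- The generic degree-six term is a combination of theta-moment terms. -/
theorem phiPolyTerm6_eq (a₁ a₂ a₃ a₄ a₅ a₆ x : ℝ) (n : ℕ) :
    phiPolyTerm6 a₁ a₂ a₃ a₄ a₅ a₆ x n = a₁ * (x ^ 1 * thetaMomentTerm 1 x n) +
      a₂ * (x ^ 2 * thetaMomentTerm 2 x n) + a₃ * (x ^ 3 * thetaMomentTerm 3 x n) +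
      a₄ * (x ^ 4 * thetaMomentTerm 4 x n) + a₅ * (x ^ 5 * thetaMomentTerm 5 x n) +
      a₆ * (x ^ 6 * thetaMomentTerm 6 x n) := by
  simp only [pow_mul_thetaMomentTerm, phiPolyTerm6]
  ring

/-- The generic degree-six series converges for `x > 0`. -/
theorem summable_phiPolyTerm6 (a₁ a₂ a₃ a₄ a₅ a₆ : ℝ) {x : ℝ} (hx : 0 < x) :
    Summable (phiPolyTerm6 a₁ a₂ a₃ a₄ a₅ a₆ x) := by
  have h : ∀ k : ℕ, ∀ a : ℝ, Summable fun n => a * (x ^ k * thetaMomentTerm k x n) := fun k a =>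
    ((summable_thetaMomentTerm k hx).mul_left (x ^ k)).mul_left a
  exact ((((((h 1 a₁).add (h 2 a₂)).add (h 3 a₃)).add (h 4 a₄)).add (h 5 a₅)).add (h 6 a₆)).congr fun n =>
    (phiPolyTerm6_eq a₁ a₂ a₃ a₄ a₅ a₆ x n).symm

/-- The generic degree-six series sums to `∑_k a_k x^k ψ_k(x)`. -/
theorem tsum_phiPolyTerm6 (a₁ a₂ a₃ a₄ a₅ a₆ : ℝ) {x : ℝ} (hx : 0 < x) :
    ∑' n, phiPolyTerm6 a₁ a₂ a₃ a₄ a₅ a₆ x n = a₁ * (x ^ 1 * thetaMoment 1 x) +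
      a₂ * (x ^ 2 * thetaMoment 2 x) + a₃ * (x ^ 3 * thetaMoment 3 x) + a₄ * (x ^ 4 * thetaMoment 4 x) +
      a₅ * (x ^ 5 * thetaMoment 5 x) + a₆ * (x ^ 6 * thetaMoment 6 x) := by
  have h : ∀ k : ℕ, ∀ a : ℝ, Summable fun n => a * (x ^ k * thetaMomentTerm k x n) := fun k a =>
    ((summable_thetaMomentTerm k hx).mul_left (x ^ k)).mul_left a
  have e : ∀ k : ℕ, ∀ a : ℝ, ∑' n, a * (x ^ k * thetaMomentTerm k x n) = a * (x ^ k * thetaMoment k x) :=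
    fun k a => by rw [tsum_mul_left, tsum_mul_left, thetaMoment]
  rw [tsum_congr (phiPolyTerm6_eq a₁ a₂ a₃ a₄ a₅ a₆ x),
    (((((h 1 a₁).add (h 2 a₂)).add (h 3 a₃)).add (h 4 a₄)).add (h 5 a₅)).tsum_add (h 6 a₆),
    ((((h 1 a₁).add (h 2 a₂)).add (h 3 a₃)).add (h 4 a₄)).tsum_add (h 5 a₅),
    (((h 1 a₁).add (h 2 a₂)).add (h 3 a₃)).tsum_add (h 4 a₄),
    ((h 1 a₁).add (h 2 a₂)).tsum_add (h 3 a₃), (h 1 a₁).tsum_add (h 2 a₂), e, e, e, e, e, e]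

/-- **`Φ‴` as one series**: `Φ‴(u) = eᵘ ∑_n P₃(y_n) e^{−y_n}` with
`P₃(y) = −128y⁵ + 1440y⁴ − 4232y³ + 3270y² − 375y`, `y_n = π(n+1)²e^{4u}`. -/
theorem deBruijnPhiDeriv₃_eq_tsum (u : ℝ) :
    deBruijnPhiDeriv₃ u = rexp u * ∑' n, phiPolyTerm6 (-375) 3270 (-4232) 1440 (-128) 0 (rexp (4 * u)) n := by
  rw [tsum_phiPolyTerm6 _ _ _ _ _ _ (Real.exp_pos _), deBruijnPhiDeriv₃, expThetaMoment_two_mul,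
    expThetaMoment_two_mul, expThetaMoment_two_mul, expThetaMoment_two_mul, expThetaMoment_two_mul]
  ring

/-- **`Φ⁗` as one series**: `Φ⁗(u) = eᵘ ∑_n P₄(y_n) e^{−y_n}` with
`P₄(y) = 512y⁶ − 8448y⁵ + 41408y⁴ − 68096y³ + 30930y² − 1875y`. -/
theorem deBruijnPhiDeriv₄_eq_tsum (u : ℝ) :
    deBruijnPhiDeriv₄ u =
      rexp u * ∑' n, phiPolyTerm6 (-1875) 30930 (-68096) 41408 (-8448) 512 (rexp (4 * u)) n := by
  rw [tsum_phiPolyTerm6 _ _ _ _ _ _ (Real.exp_pos _), deBruijnPhiDeriv₄, expThetaMoment_two_mul,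
    expThetaMoment_two_mul, expThetaMoment_two_mul, expThetaMoment_two_mul, expThetaMoment_two_mul,
    expThetaMoment_two_mul]
  ring

/-- The degree-four generic term of the toolbox is the degree-six one with `a₅ = a₆ = 0`. -/
theorem phiPolyTerm_eq_phiPolyTerm6 (a₁ a₂ a₃ a₄ x : ℝ) (n : ℕ) :
    phiPolyTerm a₁ a₂ a₃ a₄ x n = phiPolyTerm6 a₁ a₂ a₃ a₄ 0 0 x n := by
  simp only [phiPolyTerm, phiPolyTerm6]
  ring

/-! ## 3. Parity: `Φ‴` is odd, `Φ‴(0) = 0` -/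

/-- `Φ‴` is odd: `deBruijnPhiDeriv₃ (−u) = −deBruijnPhiDeriv₃ u` (from the evenness of `Φ″`,
`deBruijnPhiDeriv₂_neg_arg`, and uniqueness of derivatives).
(Csordas–Norfolk–Varga 1986, Theorem A (iii): `Φ` is even.) -/
theorem deBruijnPhiDeriv₃_neg_arg (u : ℝ) : deBruijnPhiDeriv₃ (-u) = -deBruijnPhiDeriv₃ u := by
  have hfun : (fun x => deBruijnPhiDeriv₂ (-x)) = fun x => deBruijnPhiDeriv₂ x :=
    funext fun x => deBruijnPhiDeriv₂_neg_arg x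
  have h2 : HasDerivAt (fun x => deBruijnPhiDeriv₂ (-x)) (deBruijnPhiDeriv₃ (-u) * -1) u :=
    (hasDerivAt_deBruijnPhiDeriv₂ (-u)).comp u (hasDerivAt_neg u)
  have h3 : HasDerivAt (fun x => deBruijnPhiDeriv₂ (-x)) (deBruijnPhiDeriv₃ u) u := by
    rw [hfun]; exact hasDerivAt_deBruijnPhiDeriv₂ u
  have := h2.unique h3
  linarith

/-- `Φ‴(0) = 0`.
(Csordas–Norfolk–Varga 1986, Theorem A (iii): `Φ` is even.) -/
theorem deBruijnPhiDeriv₃_zero : deBruijnPhiDeriv₃ 0 = 0 := by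
  have h := deBruijnPhiDeriv₃_neg_arg 0
  rw [neg_zero] at h
  linarith

/-- `Φ⁗` is even: `deBruijnPhiDeriv₄ (−u) = deBruijnPhiDeriv₄ u`.
(Csordas–Norfolk–Varga 1986, Theorem A (iii): `Φ` is even.) -/
theorem deBruijnPhiDeriv₄_neg_arg (u : ℝ) : deBruijnPhiDeriv₄ (-u) = deBruijnPhiDeriv₄ u := by
  have hfun : (fun x => deBruijnPhiDeriv₃ (-x)) = fun x => -deBruijnPhiDeriv₃ x :=
    funext fun x => deBruijnPhiDeriv₃_neg_arg x
  have h2 : HasDerivAt (fun x => deBruijnPhiDeriv₃ (-x)) (deBruijnPhiDeriv₄ (-u) * -1) u :=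
    (hasDerivAt_deBruijnPhiDeriv₃ (-u)).comp u (hasDerivAt_neg u)
  have h3 : HasDerivAt (fun x => deBruijnPhiDeriv₃ (-x)) (-deBruijnPhiDeriv₄ u) u := by
    rw [hfun]; exact (hasDerivAt_deBruijnPhiDeriv₃ u).neg
  have := h2.unique h3
  linarith

end Summit.RiemannHypothesis.RiemannHypothesis.Theorems.JensenPolynomials

end
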